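import Mathlib
import Summits.PneNP.PneNP.Theorems.ConvexRankGatesConvexGateBlindRainbowSums

/-!
# PneNP / ConvexRankGates — `ConvexGateBlind`: the rainbow pseudo-distribution (the one-clump functional)

Helpers (`--supports stmt-PneNP-10680`), continuing `…RainbowSums.lean`. For a colouring `h : Fin m → Fin K` with
classes `cls h i` of common size `n ≥ K + 1`, the ONE-CLUMP FUNCTIONAL on functions of vertex sets is
  `L(f) = ∑_i ∑_{g<K} ∑_{Γ ⊆ [K]∖i, #Γ=g} ∑_{C ⊆ cls i, #C = K+1-g} ω(K+1-g) · ∑_{x} f(C ∪ x(Γ))`,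
`ω(c) = (-1)^c/(c(c-1)C(n,c))`, `x` ranging over all choice functions `x c ∈ cls c` (so `C ∪ x(Γ)` is a `(K+1)`-set with
one clump `C` in class `i` and one vertex in each class of `Γ`). Up to a positive constant this is integration against
the RAINBOW PSEUDO-DISTRIBUTION `ψ_h` (the signed measure on `(K+1)`-sets described in the item evidence
ANALYSIS-seat2-s11.md). Main result of the file (`rbL_indicator`, registered stub `rainbow_marginal`): its inclusion
numbers are
  `L(𝟙[T ⊆ ·]) = [T rainbow] · K · n^{K - #T} / (K + 1 - #T)`   (`#T ≤ K`),
i.e. exactly those of "a uniformly random `(K+1)`-set meeting every class at most once" (which does not exist), with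
every non-rainbow pattern having pseudo-probability ZERO. Proof: the `x`-sum is a product over classes
(`rbL_sum_pi_indicator`), the `Γ`- and `C`-sums are superset counts, and the remaining sum over the clump size is one
of the three alternating identities of `…RainbowSums.lean` according as `T` meets the clump class in `0`, `1` or `≥ 2`
vertices. [new]
-/

namespace Summit.PneNP.PneNP.Theorems

open Finset

noncomputable section

variable {m K : ℕ}

/-! ## Colour classes and the functional -/

/-- The colour class `i` of `h`. -/
def cls (h : Fin m → Fin K) (i : Fin K) : Finset (Fin m) := univ.filter fun v => h v = i

/-- Membership in a colour class. -/
@[simp] theorem mem_cls {h : Fin m → Fin K} {i : Fin K} {v : Fin m} : v ∈ cls h i ↔ h v = i := by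
  simp [cls]

/-- The one-clump weight `ω(c) = (-1)^c / (c (c-1) C(n,c))`. -/
def clumpWt (n c : ℕ) : ℝ := (-1 : ℝ) ^ c / ((c : ℝ) * ((c : ℝ) - 1) * (n.choose c : ℝ))

/-- The ONE-CLUMP FUNCTIONAL `L` (integration against the rainbow pseudo-distribution, unnormalised). -/
def rbL (h : Fin m → Fin K) (n : ℕ) (f : Finset (Fin m) → ℝ) : ℝ :=
  ∑ i : Fin K, ∑ g ∈ range K, ∑ Γ ∈ (univ.erase i).powersetCard g, ∑ C ∈ (cls h i).powersetCard (K + 1 - g),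
    clumpWt n (K + 1 - g) * ∑ x ∈ Fintype.piFinset (fun c => cls h c), f (C ∪ Γ.image x)

/-- `L` depends only on the function (pointwise). -/
theorem rbL_congr_fun (h : Fin m → Fin K) (n : ℕ) {f f' : Finset (Fin m) → ℝ} (hff' : ∀ Q, f Q = f' Q) :
    rbL h n f = rbL h n f' := by
  rw [show f = f' from funext hff']

/-- `L` is linear: compatible with subtraction. -/
theorem rbL_sub (h : Fin m → Fin K) (n : ℕ) (f f' : Finset (Fin m) → ℝ) :
    rbL h n (fun Q => f Q - f' Q) = rbL h n f - rbL h n f' := by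
  simp only [rbL, Finset.sum_sub_distrib, mul_sub]

/-- `L` is additive. -/
theorem rbL_add (h : Fin m → Fin K) (n : ℕ) (f f' : Finset (Fin m) → ℝ) :
    rbL h n (fun Q => f Q + f' Q) = rbL h n f + rbL h n f' := by
  simp only [rbL, Finset.sum_add_distrib, mul_add]

/-- `L(0) = 0`. -/
theorem rbL_zero (h : Fin m → Fin K) (n : ℕ) : rbL h n (fun _ => 0) = 0 := by
  simp [rbL]

/-- `L` is linear: compatible with finite sums. -/
theorem rbL_sum {ι : Type*} [DecidableEq ι] (s : Finset ι) (h : Fin m → Fin K) (n : ℕ)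
    (f : ι → Finset (Fin m) → ℝ) :
    rbL h n (fun Q => ∑ l ∈ s, f l Q) = ∑ l ∈ s, rbL h n (f l) := by
  induction s using Finset.induction_on with
  | empty => simpa using rbL_zero h n
  | insert a s ha ih =>
    rw [Finset.sum_insert ha, ← ih, ← rbL_add]
    exact rbL_congr_fun h n (fun Q => by rw [Finset.sum_insert ha])

/-- `L` is linear: compatible with scalars. -/
theorem rbL_smul (h : Fin m → Fin K) (n : ℕ) (a : ℝ) (f : Finset (Fin m) → ℝ) :
    rbL h n (fun Q => a * f Q) = a * rbL h n f := by
  simp only [rbL, Finset.mul_sum]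
  refine Finset.sum_congr rfl fun _ _ => Finset.sum_congr rfl fun _ _ => Finset.sum_congr rfl fun _ _ =>
    Finset.sum_congr rfl fun _ _ => Finset.sum_congr rfl fun _ _ => by ring

/-- The sets `C ∪ x(Γ)` visited by `L` are `(K+1)`-sets. -/
theorem card_clump_union_image {h : Fin m → Fin K} {i : Fin K} {g : ℕ} {Γ : Finset (Fin K)}
    (hΓ : Γ ∈ (univ.erase i).powersetCard g) {C : Finset (Fin m)} (hC : C ∈ (cls h i).powersetCard (K + 1 - g))
    {x : Fin K → Fin m} (hx : x ∈ Fintype.piFinset fun c => cls h c) (hg : g < K) :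
    (C ∪ Γ.image x).card = K + 1 := by
  rw [mem_powersetCard] at hΓ hC
  rw [Fintype.mem_piFinset] at hx
  have hxinj : Set.InjOn x ↑Γ := by
    intro a _ b _ hab
    have ha := mem_cls.1 (hx a)
    have hb := mem_cls.1 (hx b)
    rw [← ha, ← hb, hab]
  have hdisj : Disjoint C (Γ.image x) := by
    rw [Finset.disjoint_left]
    intro v hvC hvx
    obtain ⟨c, hc, rfl⟩ := mem_image.1 hvx
    have h1 : h (x c) = i := mem_cls.1 (hC.1 hvC)
    have h2 : h (x c) = c := mem_cls.1 (hx c)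
    have : c ≠ i := (mem_erase.1 (hΓ.1 hc)).1
    exact this (h2.symm.trans h1)
  rw [card_union_of_disjoint hdisj, card_image_of_injOn hxinj, hC.2, hΓ.2]
  omega

/-- `L` only sees the values of `f` on `(K+1)`-sets. -/
theorem rbL_congr (h : Fin m → Fin K) (n : ℕ) {f f' : Finset (Fin m) → ℝ}
    (hff' : ∀ Q : Finset (Fin m), Q.card = K + 1 → f Q = f' Q) : rbL h n f = rbL h n f' := by
  unfold rbL
  refine Finset.sum_congr rfl fun i _ => Finset.sum_congr rfl fun g hg => Finset.sum_congr rfl fun Γ hΓ =>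
    Finset.sum_congr rfl fun C hC => ?_
  congr 1
  refine Finset.sum_congr rfl fun x hx => hff' _ ?_
  exact card_clump_union_image hΓ hC hx (mem_range.1 hg)

/-! ## The `x`-sum of an inclusion indicator is a product over classes -/

/-- The fibres of the choice functions `x` compatible with `T ⊆ C ∪ x(Γ)` outside class `i`. -/
def pinFib (h : Fin m → Fin K) (T : Finset (Fin m)) (i c : Fin K) : Finset (Fin m) :=
  (cls h c).filter fun y => ∀ v ∈ T, h v ≠ i → h v = c → y = v

/-- For a choice function `x` (`h (x c) = c`), `i ∉ Γ`, `C ⊆ cls i`: `T ⊆ C ∪ x(Γ)` iff the class-`i` part of `T` lies in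
`C`, the other colours of `T` lie in `Γ`, and `x` picks the vertices of `T` in those colours. -/
theorem subset_clump_union_image_iff {h : Fin m → Fin K} {i : Fin K} {Γ : Finset (Fin K)} (hiΓ : i ∉ Γ)
    {C : Finset (Fin m)} (hC : C ⊆ cls h i) {x : Fin K → Fin m} (hx : ∀ c, h (x c) = c) (T : Finset (Fin m)) :
    T ⊆ C ∪ Γ.image x ↔
      (T.filter fun v => h v = i) ⊆ C ∧ (∀ v ∈ T, h v ≠ i → h v ∈ Γ) ∧ (∀ v ∈ T, h v ≠ i → x (h v) = v) := by
  constructor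
  · intro hT
    have key : ∀ v ∈ T, (h v = i → v ∈ C) ∧ (h v ≠ i → h v ∈ Γ ∧ x (h v) = v) := by
      intro v hv
      rcases mem_union.1 (hT hv) with hvC | hvx
      · have hvi : h v = i := mem_cls.1 (hC hvC)
        exact ⟨fun _ => hvC, fun hne => (hne hvi).elim⟩
      · obtain ⟨c, hc, rfl⟩ := mem_image.1 hvx
        have hxc : h (x c) = c := hx c
        refine ⟨fun hci => ?_, fun _ => ⟨?_, ?_⟩⟩
        · exact (hiΓ (hxc.symm.trans hci ▸ hc)).elim
        · rw [hxc]; exact hc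
        · rw [hxc]
    refine ⟨fun v hv => ?_, fun v hv hne => ((key v hv).2 hne).1, fun v hv hne => ((key v hv).2 hne).2⟩
    rw [mem_filter] at hv
    exact (key v hv.1).1 hv.2
  · rintro ⟨hTi, hTΓ, hTx⟩ v hv
    by_cases hvi : h v = i
    · exact mem_union_left _ (hTi (mem_filter.2 ⟨hv, hvi⟩))
    · refine mem_union_right _ (mem_image.2 ⟨h v, hTΓ v hv hvi, hTx v hv hvi⟩)

/-- **The `x`-sum of `𝟙[T ⊆ C ∪ x(Γ)]` over all choice functions** is `[T_i ⊆ C] · [colours of T∖T_i ⊆ Γ] · #piFinset`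
of the pinned fibres. -/
theorem rbL_sum_pi_indicator (h : Fin m → Fin K) {i : Fin K} {Γ : Finset (Fin K)} (hiΓ : i ∉ Γ)
    {C : Finset (Fin m)} (hC : C ⊆ cls h i) (T : Finset (Fin m)) :
    (∑ x ∈ Fintype.piFinset (fun c => cls h c), if T ⊆ C ∪ Γ.image x then (1 : ℝ) else 0) =
      if (T.filter fun v => h v = i) ⊆ C ∧ (∀ v ∈ T, h v ≠ i → h v ∈ Γ) then
        ((Fintype.piFinset (pinFib h T i)).card : ℝ) else 0 := by
  have hsub : Fintype.piFinset (pinFib h T i) ⊆ Fintype.piFinset (fun c => cls h c) :=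
    Fintype.piFinset_subset _ _ fun c => filter_subset _ _
  split_ifs with hcond
  · rw [Finset.sum_boole]
    have hset : (Fintype.piFinset fun c => cls h c).filter (fun x => T ⊆ C ∪ Γ.image x) =
        Fintype.piFinset (pinFib h T i) := by
      ext x
      simp only [mem_filter, Fintype.mem_piFinset]
      constructor
      · rintro ⟨hx, hT⟩ c
        have hx' : ∀ c, h (x c) = c := fun c => mem_cls.1 (hx c)
        rw [pinFib, mem_filter]
        refine ⟨hx c, fun v hv hne hvc => ?_⟩
        have := ((subset_clump_union_image_iff hiΓ hC hx' T).1 hT).2.2 v hv hne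
        rw [hvc] at this
        exact this
      · intro hx
        have hx1 : ∀ c, x c ∈ cls h c := fun c => (mem_filter.1 (hx c)).1
        have hx' : ∀ c, h (x c) = c := fun c => mem_cls.1 (hx1 c)
        refine ⟨hx1, (subset_clump_union_image_iff hiΓ hC hx' T).2 ⟨hcond.1, hcond.2, fun v hv hne => ?_⟩⟩
        exact (mem_filter.1 (hx (h v))).2 v hv hne rfl
    rw [hset]
  · refine Finset.sum_eq_zero fun x hx => ?_
    rw [if_neg]
    intro hT
    have hx' : ∀ c, h (x c) = c := fun c => mem_cls.1 (Fintype.mem_piFinset.1 hx c)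
    have := (subset_clump_union_image_iff hiΓ hC hx' T).1 hT
    exact hcond ⟨this.1, this.2.1⟩

/-- The pinned fibres have `1`, `n` or `0` elements; their product is `[T ∖ T_i rainbow] · n^{K - #(T ∖ T_i)}`
(classes of common size `n`). -/
theorem card_piFinset_pinFib (h : Fin m → Fin K) {n : ℕ} (hn : ∀ c, (cls h c).card = n) (T : Finset (Fin m))
    (i : Fin K) :
    (Fintype.piFinset (pinFib h T i)).card =
      if Set.InjOn h ↑(T.filter fun v => h v ≠ i) then n ^ (K - (T.filter fun v => h v ≠ i).card) else 0 := by
  classical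
  set T' := T.filter fun v => h v ≠ i with hT'
  rw [Fintype.card_piFinset]
  split_ifs with hinj
  · -- every fibre is a singleton (colour used by `T'`) or a whole class
    have hfib : ∀ c, (pinFib h T i c).card = if c ∈ T'.image h then 1 else n := by
      intro c
      split_ifs with hc
      · obtain ⟨v, hv, hvc⟩ := mem_image.1 hc
        have hv' := mem_filter.1 hv
        have : pinFib h T i c = {v} := by
          ext y
          simp only [pinFib, mem_filter, mem_cls, mem_singleton]
          constructor
          · rintro ⟨-, hy⟩
            exact hy v hv'.1 hv'.2 hvc
          · rintro rfl
            refine ⟨hvc, fun w hw hwi hwc => ?_⟩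
            exact (hinj (mem_coe.2 hv) (mem_coe.2 (mem_filter.2 ⟨hw, hwi⟩)) (hvc.trans hwc.symm))
        rw [this, card_singleton]
      · have : pinFib h T i c = cls h c := by
          ext y
          simp only [pinFib, mem_filter, mem_cls, and_iff_left_iff_imp]
          intro _ w hw hwi hwc
          exact (hc (mem_image.2 ⟨w, mem_filter.2 ⟨hw, hwi⟩, hwc⟩)).elim
        rw [this, hn c]
    simp_rw [hfib]
    rw [Finset.prod_ite, Finset.prod_const_one, one_mul, Finset.prod_const]
    congr 1
    have h1 : (univ.filter fun c => c ∉ T'.image h) = univ \ T'.image h := by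
      ext c; simp
    rw [h1, card_sdiff_of_subset (subset_univ _), card_univ, Fintype.card_fin, card_image_of_injOn hinj]
  · -- two vertices of `T'` share a colour: that fibre is empty
    simp only [Set.InjOn, not_forall] at hinj
    obtain ⟨v, hv, w, hw, hvw, hne⟩ := hinj
    refine Finset.prod_eq_zero (mem_univ (h v)) ?_
    rw [Finset.card_eq_zero, Finset.eq_empty_iff_forall_notMem]
    intro y hy
    rw [pinFib, mem_filter] at hy
    have hv' := mem_filter.1 (mem_coe.1 hv)
    have hw' := mem_filter.1 (mem_coe.1 hw)
    have h1 := hy.2 v hv'.1 hv'.2 rfl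
    have h2 := hy.2 w hw'.1 hw'.2 hvw.symm
    exact hne (h1.symm.trans h2)

/-! ## Superset counts for the clump and for the colour set -/

/-- Clumps of size `c` through a prescribed subset `B` of class `i`:
`#{C ⊆ cls i : #C = c, B ⊆ C} · C(n, #B) = C(n, c) · C(c, #B)` (both sides vanish when `#B > c`). -/
theorem card_clumps_superset (h : Fin m → Fin K) {n : ℕ} (hn : ∀ c, (cls h c).card = n) (i : Fin K)
    {B : Finset (Fin m)} (hB : B ⊆ cls h i) (c : ℕ) :
    ((((cls h i).powersetCard c).filter fun C => B ⊆ C).card : ℝ) * (n.choose B.card : ℝ) =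
      (n.choose c : ℝ) * (c.choose B.card : ℝ) := by
  by_cases hBc : B.card ≤ c
  · rw [rb_card_filter_powersetCard_superset hB hBc, hn i]
    have := Nat.choose_mul (n := n) (k := c) (s := B.card) hBc
    have h' : (n.choose c : ℝ) * (c.choose B.card : ℝ) = (n.choose B.card : ℝ) * ((n - B.card).choose (c - B.card) : ℝ) := by
      exact_mod_cast this
    rw [h']
    ring
  · push Not at hBc
    have h0 : (((cls h i).powersetCard c).filter fun C => B ⊆ C) = ∅ := by
      rw [Finset.eq_empty_iff_forall_notMem]
      intro C hC
      rw [mem_filter, mem_powersetCard] at hC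
      have := card_le_card hC.2
      omega
    rw [h0, card_empty, Nat.choose_eq_zero_of_lt hBc]
    simp

/-- Colour sets of size `g` through a prescribed set `H` of colours other than `i`:
`#{Γ ⊆ [K] ∖ i : #Γ = g, H ⊆ Γ} = [#H ≤ g] · C(K - 1 - #H, g - #H)`. -/
theorem card_colourSets_superset {i : Fin K} {H : Finset (Fin K)} (hH : H ⊆ univ.erase i) (g : ℕ) :
    ((((univ.erase i).powersetCard g).filter fun Γ => H ⊆ Γ).card) =
      if H.card ≤ g then (K - 1 - H.card).choose (g - H.card) else 0 := by
  split_ifs with hHg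
  · rw [rb_card_filter_powersetCard_superset hH hHg, card_erase_of_mem (mem_univ _), card_univ, Fintype.card_fin]
  · push Not at hHg
    rw [Finset.card_eq_zero, Finset.eq_empty_iff_forall_notMem]
    intro Γ hΓ
    rw [mem_filter, mem_powersetCard] at hΓ
    have := card_le_card hΓ.2
    omega

/-- A double sum of a product indicator splits. -/
theorem sum_sum_ite_and {β γ : Type*} (s : Finset β) (t : Finset γ) (A : γ → Prop) (B : β → Prop)
    [DecidablePred A] [DecidablePred B] (w P : ℝ) :
    (∑ b ∈ s, ∑ c ∈ t, w * (if A c ∧ B b then P else 0)) =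
      w * P * ((s.filter B).card : ℝ) * ((t.filter A).card : ℝ) := by
  have inner : ∀ b ∈ s, (∑ c ∈ t, w * (if A c ∧ B b then P else 0)) =
      if B b then w * P * ((t.filter A).card : ℝ) else 0 := by
    intro b _
    by_cases hb : B b
    · simp only [hb, and_true, if_true]
      rw [← Finset.mul_sum]
      have : (∑ c ∈ t, (if A c then P else 0)) = P * ((t.filter A).card : ℝ) := by
        rw [← Finset.sum_boole, Finset.mul_sum]
        refine Finset.sum_congr rfl fun c _ => ?_
        split_ifs <;> simp
      rw [this, mul_assoc]
    · simp [hb]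
  rw [Finset.sum_congr rfl inner, ← Finset.sum_filter, Finset.sum_const, nsmul_eq_mul]
  ring

/-- **Registered helper stub (pinned-fibre product).** Restatement of `card_piFinset_pinFib` with all parameters
explicit: the number of choice functions pinned by `T` outside class `i` is `[T ∖ cls i rainbow] · n^{K - #(T ∖ cls i)}`. -/
theorem rainbow_pi_count : ∀ {m K n : ℕ} (h : Fin m → Fin K), (∀ c, (cls h c).card = n) → ∀ (T : Finset (Fin m)) (i : Fin K), (Fintype.piFinset (pinFib h T i)).card = if Set.InjOn h ↑(T.filter fun v => h v ≠ i) then n ^ (K - (T.filter fun v => h v ≠ i).card) else 0 := by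
  intro m K n h hn T i
  exact card_piFinset_pinFib h hn T i

end

end Summit.PneNP.PneNP.Theorems
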